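import Summits.QuantumFields.YangMills.Theorems.BalabanUVNodesN07CritCurrentForm

/-!
# NODE N07 ([15] = [Balaban1985Variational]) — MODULE 35i: THE MULTI-SCALE TANGENT AND CURRENT FORMS FROM A LOCAL CORRECTOR OF THE CONSTRAINT
# (every determining set `𝐁`; the socket ROAD B of HOME `LOCATED-MULTISCALE-FIBRE.md` § B — or print's chart (47) — plugs into)

Cell `pub-ymgap`, seat `pub-ymgap-dag-n07-e` generation 14 (R141 (C), DAG node N07).  `--kind proof --supports stmt-QuantumFields-20541 --as helper` (K0⁷; V18 stub 1
`stub_prop8StepCoP13` states criticality on the MULTI-SCALE fibre of `genSet s.Ω k` in the CURVE form `IsCritOnFibre`).  Modules 35c–35e proved «curve-critical ⇒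
tangent-critical» at the ONE-SCALE pin from the route `UnitScaleTilt`'s exact corrector; the step used of the corrector is isolated here as a HYPOTHESIS about the fibre of an
ARBITRARY determining set `𝐁` at `U` — a LOCAL LINEAR CORRECTOR: every configuration `U′` bond-wise `ρ`-close to `U` whose constrained averages are `η`-close to the datum is
`q·η`-close to a configuration ON the fibre (spelled out in the signatures; at the one-scale pin it is 35c's `exists_iter_eq_of_near_SU`, §3) —
and the conclusion is drawn for every `𝐁`: ★★★ curve-critical on `𝔅(𝐁, W)` ⇒ tangent-critical on the JOINT KERNEL of the linearised constraints (all levels, all pinned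
bonds), ⇒ (35f∕35g) the current form `Σ_b Re Tr(U_bX_bU_b⋆ · η·(D^{η*}_U∂U)(b)) = 0`.  So a multi-scale corrector for `genSet` (ROAD B (B1)–(B5), or the chart (47) read as a
corrector) is ALL that separates stub 1's hypothesis from print's (82) on the multi-scale tangent space.

WHAT IS PROVED (sorry-free, no definition, axioms standard):
* §1 ★ `exists_curve_of_corrector` — the ANALYTIC CORE of 35c §2 made abstract: a fibre predicate `Fib`, a defect `η = o(t)` with `η 0 = 0`, a condition `good` holding near
  `0` and at `0`, and for every good `t` a point of `Fib` within `q·η(t)` of `U·exp(tX)` bond-wise ⟹ a curve `γ`, `γ 0 = U`, bond-wise matrix velocity `U_b X_b` at `0`,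
  `Fib (γ t)` for `t` near `0`.
* §2 (the local-corrector hypothesis SPELLED OUT in each signature — no definition introduced; the joint-kernel velocity condition makes the total defect along the ray an
  `o(t)`): ★★ `exists_fibreCurve_of_localCorrector`; ★★★ `hasDerivAt_wilsonAction4_expChart_of_isCritOnFibre_of_corrector` (curve-critical ⇒ tangent-critical on the joint kernel,
  every `𝐁`), `deriv_…`; ★★★ `sum_re_trace_covDivT_eq_zero_of_isCritOnFibre_of_corrector` (the current form, 35g §1 by name).
CONSISTENCY (not re-derived): at the one-scale pin `𝐁 = atScale k` the hypothesis is what 35c's `k`-fold corrector `exists_iter_eq_of_near_SU` supplies on the good set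
(`q = (2∕|I|⁻¹)^k`), and the conclusion is 35c's `hasDerivAt_wilsonAction4_expChart_of_isCritOnFibre_atScale`.
HONEST FRAMING: count-neutral kernel bookkeeping (real analysis of `o(t)` + the seat's earlier modules by name); the multi-scale corrector for `genSet` is NOT constructed here
(ROAD B's L3–L5 or the (47) transfer supply it); nothing of [15] Sects. B–F; stub 1 ∕ K0⁷ NOT closed; N07 NOT discharged (5∕27); one finite T⁴ programme at fixed ε — NOT
continuum ∕ ℝ⁴ ∕ OS ∕ mass gap ∕ Clay.  No `sorry`, no `instance`, no `notation`.
References: T. Bałaban, CMP **102** (1985) 277–309 [Balaban1985Variational] ((3),(5)–(6) p.278, Sect. C (47) p.285, Prop. 3 p.289, (82)–(83) p.290, (141) p.299, p.300, Prop. 8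
p.304); CMP **99** (1985) 75–102 [Balaban1985RegularSpaces] ((1.1)–(1.2) p.76); CMP **119** (1988) 243–285 [Balaban1988Convergent] ((2.2), (2.10)–(2.12) pp.255–256).
-/

noncomputable section

open scoped Matrix.Norms.L2Operator Topology BigOperators
open Filter Asymptotics Function NormedSpace

namespace Summit.QuantumFields.YangMills.BalabanUVNodes.N07CritMultiScaleOfCorrector

open Literature.MathematicalPhysics.QuantumFieldTheory.Balaban1983to89
open Literature.MathematicalPhysics.QuantumFieldTheory.Balaban1983to89.T4Continuum (T4Family)
open Literature.MathematicalPhysics.QuantumFieldTheory.Balaban1983to89.B15DeterminingSets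
open Literature.MathematicalPhysics.QuantumFieldTheory.Balaban1983to89.BlockAveraging
open Literature.MathematicalPhysics.QuantumFieldTheory.Balaban1983to89.BlockAveragingEMLHaarAC (emlWeight)
open Literature.MathematicalPhysics.QuantumFieldTheory.Balaban1983to89.ExpMeanLog (expMeanLogSU deltaSU deltaSU_pos)
open Literature.MathematicalPhysics.QuantumFieldTheory.Balaban1983to89.T4AdjointCovarianceUnitary (lieSU)
open Literature.MathematicalPhysics.QuantumFieldTheory.Balaban1983to89.B10Eq27TorusAxialLog (toUField unitsField)
open Literature.MathematicalPhysics.QuantumFieldTheory.Balaban1983to89.B10Eq68TorusRegularity (covDivT)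
open Literature.MathematicalPhysics.QuantumFieldTheory.Balaban1983to89.Node00
open Summit.QuantumFields.YangMills.Theorems.BlockAvgCorrector (stokesConst stokesConst_nonneg emlWeight_pos emlWeight_le_one)
open Summit.QuantumFields.YangMills.BalabanUVNodes.N07CritTangentAtRecord (exists_iter_eq_of_near_SU tendsto_coeField_expChart_ray
  eventually_plaqSmall_iter_of_tendsto)
open Summit.QuantumFields.YangMills.BalabanUVNodes.N07CritCurrentForm (sum_re_trace_covDivT_eq_zero_of_hasDerivAt_zero)

/-! ## §1  The analytic core: a curve in a set from approximate points (`corrector + o(t)`) -/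

section Core

variable {P : Params} {N : ℕ} [NeZero N]

omit [NeZero N] in
/-- ★ **A CURVE IN `Fib` WITH VELOCITY `U·X` FROM A CORRECTOR.**  Let `η : ℝ → ℝ` be an `o(t)` at `0` with `η 0 = 0`, `good` a condition holding for `t` near `0` and at `0`,
and suppose that for every good `t` some configuration satisfying `Fib` is bond-wise within `q·η t` (operator norm of matrices) of `U·exp(tX)`.  Then there is a curve `γ`
with `γ 0 = U`, bond-wise matrix velocity `U_b·X_b` at `0`, and `Fib (γ t)` for all `t` near `0`.  (Choice of the corrected point on the good set, `U` elsewhere;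
`γ − U·exp(tX) = O(η) = o(t)` bond-wise.) [cite: Balaban1985Variational, Sect. C (47) p.285, Prop. 3 p.289, (82)–(83) p.290] -/
theorem exists_curve_of_corrector (U : GaugeField P 0 (SU N)) (X : PBond P 0 → lieSU (Fin N)) (Fib : GaugeField P 0 (SU N) → Prop)
    {η : ℝ → ℝ} (hη_nonneg : ∀ t, 0 ≤ η t) (hηo : η =o[𝓝 (0 : ℝ)] fun t => t) (hη0 : η 0 = 0) {q : ℝ}
    {good : ℝ → Prop} (hgood : ∀ᶠ t in 𝓝 (0 : ℝ), good t) (hgood0 : good 0)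
    (hcorr : ∀ t, good t → ∃ U' : GaugeField P 0 (SU N), Fib U' ∧
      ∀ b, ‖((U' b : SU N) : Matrix (Fin N) (Fin N) ℂ) - ((expChart U (t • X) b : SU N) : Matrix (Fin N) (Fin N) ℂ)‖ ≤ q * η t) :
    ∃ γ : ℝ → GaugeField P 0 (SU N), γ 0 = U ∧
      (∀ b : PBond P 0, HasDerivAt (fun t => ((γ t b : SU N) : Matrix (Fin N) (Fin N) ℂ))
        ((U b : Matrix (Fin N) (Fin N) ℂ) * (X b : Matrix (Fin N) (Fin N) ℂ)) 0) ∧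
      ∀ᶠ t in 𝓝 (0 : ℝ), Fib (γ t) := by
  classical
  set Γ₀ : ℝ → GaugeField P 0 (SU N) := fun t => expChart U (t • X) with hΓ₀
  have hΓ₀0 : Γ₀ 0 = U := by simp only [hΓ₀, zero_smul, expChart_zero]
  set γ : ℝ → GaugeField P 0 (SU N) := fun t => if h : good t then Classical.choose (hcorr t h) else U with hγdef
  have hγ_spec : ∀ t, ∀ h : good t, Fib (γ t) ∧
      ∀ b, ‖((γ t b : SU N) : Matrix (Fin N) (Fin N) ℂ) - (Γ₀ t b : Matrix (Fin N) (Fin N) ℂ)‖ ≤ q * η t := by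
    intro t h
    have hγt : γ t = Classical.choose (hcorr t h) := by
      rw [hγdef]
      exact dif_pos h
    rw [hγt]
    exact Classical.choose_spec (hcorr t h)
  have hγ0 : γ 0 = U := by
    obtain ⟨-, hdist⟩ := hγ_spec 0 hgood0
    funext b
    apply Subtype.ext
    have hb := hdist b
    rw [hη0, mul_zero] at hb
    have hb' : ((γ 0 b : SU N) : Matrix (Fin N) (Fin N) ℂ) = (Γ₀ 0 b : Matrix (Fin N) (Fin N) ℂ) :=
      sub_eq_zero.1 (norm_le_zero_iff.1 hb)
    rw [hb', hΓ₀0]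
  refine ⟨γ, hγ0, fun b => ?_, hgood.mono fun t ht => (hγ_spec t ht).1⟩
  have hΓ₀b : HasDerivAt (fun t => ((Γ₀ t b : SU N) : Matrix (Fin N) (Fin N) ℂ))
      ((U b : Matrix (Fin N) (Fin N) ℂ) * (X b : Matrix (Fin N) (Fin N) ℂ)) 0 :=
    hasDerivAt_coe_expChart_along (U := U) (c := fun t : ℝ => t • X) (hasDerivAt_ray X) (zero_smul ℝ X) b
  have hdiff : (fun t => ((γ t b : SU N) : Matrix (Fin N) (Fin N) ℂ) - (Γ₀ t b : Matrix (Fin N) (Fin N) ℂ)) =o[𝓝 0] fun t => t := by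
    have hbig : (fun t => ((γ t b : SU N) : Matrix (Fin N) (Fin N) ℂ) - (Γ₀ t b : Matrix (Fin N) (Fin N) ℂ)) =O[𝓝 0] η := by
      refine IsBigO.of_bound q (hgood.mono fun t ht => ?_)
      rw [Real.norm_of_nonneg (hη_nonneg t)]
      exact (hγ_spec t ht).2 b
    exact hbig.trans_isLittleO hηo
  rw [hasDerivAt_iff_isLittleO] at hΓ₀b ⊢
  simp only [sub_zero] at hΓ₀b ⊢
  have hsum := hΓ₀b.add hdiff
  refine hsum.congr_left fun t => ?_
  rw [hγ0, hΓ₀0]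
  abel

end Core

/-! ## §2  The local-corrector hypothesis for an arbitrary determining set, and the multi-scale tangent ∕ current forms from it -/

section MultiScale

variable {F : T4Family} {N : ℕ} [NeZero N]

/-! THE LOCAL-CORRECTOR (hcorr : ∀ U' : GaugeField (F.P K) 0 (SU N), (∀ b, ‖((U' b : SU N) : Matrix (Fin N) (Fin N) ℂ) - (U b : Matrix (Fin N) (Fin N) ℂ)‖ ≤ ρ) →
      ∀ η : ℝ, 0 ≤ η →
        (∀ j, j ≤ k₀ → ∀ c ∈ bondsOf (𝔹 j),
          ‖((avgFamily (avOfRecord F N K) U' j c : SU N) : Matrix (Fin N) (Fin N) ℂ) - ((W j c : SU N) : Matrix (Fin N) (Fin N) ℂ)‖ ≤ η) →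
        ∃ U'' : GaugeField (F.P K) 0 (SU N), AgreeOn 𝔹 (avgFamily (avOfRecord F N K) U'') W ∧
          ∀ b, ‖((U'' b : SU N) : Matrix (Fin N) (Fin N) ℂ) - (U' b : Matrix (Fin N) (Fin N) ℂ)‖ ≤ q * η)OTHESIS (spelled out in each signature; no definition is introduced): «every configuration `U′` bond-wise `ρ`-close to `U` (matrices, operator norm)
whose constrained averages are `η`-close to the datum — `‖Ū′^j(c) − W_j(c)‖ ≤ η` for every level `j ≤ k₀` and every bond `c` meeting `Γ_j` — is bond-wise `q·η`-close to a
configuration `U″` ON the fibre `𝔅(𝐁, W)`».  What 35c's `k`-fold corrector gives at the one-scale pin; what ROAD B (HOME `LOCATED-MULTISCALE-FIBRE.md` § B) or print's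
linearizing transformation (47) are to give for `genSet`.  THE JOINT (hX : ∀ j, j ≤ k₀ → ∀ c ∈ bondsOf (𝔹 j), HasDerivAt
      (fun t : ℝ => ((avgFamily (avOfRecord F N K) (expChart U (t • X)) j c : SU N) : Matrix (Fin N) (Fin N) ℂ)) 0 0)NEL: every constrained average `Ū^j(U·exp(tX))(c)`, `j ≤ k₀`, `c` meeting `Γ_j`, has matrix velocity
`0` at `t = 0` (print's (83) at every scale). -/

/-- ★★ **MULTI-SCALE FIBRE CURVES WITH PRESCRIBED JOINT-(hX : ∀ j, j ≤ k₀ → ∀ c ∈ bondsOf (𝔹 j), HasDerivAt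
      (fun t : ℝ => ((avgFamily (avOfRecord F N K) (expChart U (t • X)) j c : SU N) : Matrix (Fin N) (Fin N) ℂ)) 0 0)NEL VELOCITY FROM A LOCAL CORRECTOR**: `U` on the fibre of a determining set `𝐁` (levels `≤ k₀` constrained), a local
linear corrector at `U` (modulus `q`, radius `ρ > 0`), and a joint-kernel direction `X` ⟹ a curve `γ`, `γ 0 = U`, bond-wise velocity `U·X`, IN THE FIBRE for `t` near `0`.
The defect `Σ_{j ≤ k₀} Σ_{c meeting Γ_j} ‖Ū^j(U·exp(tX))(c) − W_j(c)‖` is an `o(t)` by the kernel condition, and the ray is eventually `ρ`-close to `U`; then §1.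
[cite: Balaban1985Variational, (3),(5) p.278, Sect. C (47) p.285, Prop. 3 p.289, (82)–(83) p.290; Balaban1988Convergent, (2.2), (2.10)–(2.12) pp.255–256] -/
theorem exists_fibreCurve_of_localCorrector {K : ℕ} {𝔹 : DetSet (F.P K)} {k₀ : ℕ} {W : MSField (F.P K) (SU N)}
    {U : GaugeField (F.P K) 0 (SU N)} (hfib : AgreeOn 𝔹 (avgFamily (avOfRecord F N K) U) W) {q ρ : ℝ} (hρ : 0 < ρ)
    (hcorr : ∀ U' : GaugeField (F.P K) 0 (SU N), (∀ b, ‖((U' b : SU N) : Matrix (Fin N) (Fin N) ℂ) - (U b : Matrix (Fin N) (Fin N) ℂ)‖ ≤ ρ) →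
      ∀ η : ℝ, 0 ≤ η →
        (∀ j, j ≤ k₀ → ∀ c ∈ bondsOf (𝔹 j),
          ‖((avgFamily (avOfRecord F N K) U' j c : SU N) : Matrix (Fin N) (Fin N) ℂ) - ((W j c : SU N) : Matrix (Fin N) (Fin N) ℂ)‖ ≤ η) →
        ∃ U'' : GaugeField (F.P K) 0 (SU N), AgreeOn 𝔹 (avgFamily (avOfRecord F N K) U'') W ∧
          ∀ b, ‖((U'' b : SU N) : Matrix (Fin N) (Fin N) ℂ) - (U' b : Matrix (Fin N) (Fin N) ℂ)‖ ≤ q * η) {X : PBond (F.P K) 0 → lieSU (Fin N)}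
    (hX : ∀ j, j ≤ k₀ → ∀ c ∈ bondsOf (𝔹 j), HasDerivAt
      (fun t : ℝ => ((avgFamily (avOfRecord F N K) (expChart U (t • X)) j c : SU N) : Matrix (Fin N) (Fin N) ℂ)) 0 0) :
    ∃ γ : ℝ → GaugeField (F.P K) 0 (SU N), γ 0 = U ∧
      (∀ b : PBond (F.P K) 0, HasDerivAt (fun t => ((γ t b : SU N) : Matrix (Fin N) (Fin N) ℂ))
        ((U b : Matrix (Fin N) (Fin N) ℂ) * (X b : Matrix (Fin N) (Fin N) ℂ)) 0) ∧
      ∀ᶠ t in 𝓝 (0 : ℝ), AgreeOn 𝔹 (avgFamily (avOfRecord F N K) (γ t)) W := by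
  classical
  -- the total defect along the ray
  set D : GaugeField (F.P K) 0 (SU N) → ℝ := fun V => ∑ j ∈ Finset.range (k₀ + 1), ∑ c : PBond (F.P K) j,
    if c ∈ bondsOf (𝔹 j) then ‖((avgFamily (avOfRecord F N K) V j c : SU N) : Matrix (Fin N) (Fin N) ℂ) - ((W j c : SU N) : Matrix (Fin N) (Fin N) ℂ)‖ else 0
    with hD
  have hterm_nonneg : ∀ (V : GaugeField (F.P K) 0 (SU N)) (j : ℕ) (c : PBond (F.P K) j),
      0 ≤ (if c ∈ bondsOf (𝔹 j) then ‖((avgFamily (avOfRecord F N K) V j c : SU N) : Matrix (Fin N) (Fin N) ℂ) - ((W j c : SU N) : Matrix (Fin N) (Fin N) ℂ)‖ else 0) := by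
    intro V j c
    split_ifs
    · exact norm_nonneg _
    · exact le_rfl
  have hD_nonneg : ∀ V, 0 ≤ D V := fun V => Finset.sum_nonneg fun j _ => Finset.sum_nonneg fun c _ => hterm_nonneg V j c
  have hD_le : ∀ V {j : ℕ}, j ≤ k₀ → ∀ {c : PBond (F.P K) j}, c ∈ bondsOf (𝔹 j) →
      ‖((avgFamily (avOfRecord F N K) V j c : SU N) : Matrix (Fin N) (Fin N) ℂ) - ((W j c : SU N) : Matrix (Fin N) (Fin N) ℂ)‖ ≤ D V := by
    intro V j hj c hc
    have hj' : j ∈ Finset.range (k₀ + 1) := Finset.mem_range.2 (Nat.lt_succ_of_le hj)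
    refine le_trans ?_ (Finset.single_le_sum (f := fun j => ∑ c : PBond (F.P K) j,
      if c ∈ bondsOf (𝔹 j) then ‖((avgFamily (avOfRecord F N K) V j c : SU N) : Matrix (Fin N) (Fin N) ℂ) - ((W j c : SU N) : Matrix (Fin N) (Fin N) ℂ)‖ else 0)
      (fun j _ => Finset.sum_nonneg fun c _ => hterm_nonneg V j c) hj')
    refine le_trans ?_ (Finset.single_le_sum (f := fun c : PBond (F.P K) j =>
      if c ∈ bondsOf (𝔹 j) then ‖((avgFamily (avOfRecord F N K) V j c : SU N) : Matrix (Fin N) (Fin N) ℂ) - ((W j c : SU N) : Matrix (Fin N) (Fin N) ℂ)‖ else 0)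
      (fun c _ => hterm_nonneg V j c) (Finset.mem_univ c))
    rw [if_pos hc]
  have hD0 : D (expChart U ((0 : ℝ) • X)) = 0 := by
    rw [zero_smul, expChart_zero]
    refine Finset.sum_eq_zero fun j _ => Finset.sum_eq_zero fun c _ => ?_
    split_ifs with hc
    · rw [hfib j c hc, sub_self, norm_zero]
    · rfl
  have hDo : (fun t : ℝ => D (expChart U (t • X))) =o[𝓝 (0 : ℝ)] fun t => t := by
    have hterm : ∀ j ∈ Finset.range (k₀ + 1), ∀ c : PBond (F.P K) j,
        (fun t : ℝ => if c ∈ bondsOf (𝔹 j) then ‖((avgFamily (avOfRecord F N K) (expChart U (t • X)) j c : SU N) : Matrix (Fin N) (Fin N) ℂ) -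
          ((W j c : SU N) : Matrix (Fin N) (Fin N) ℂ)‖ else 0) =o[𝓝 (0 : ℝ)] fun t => t := by
      intro j hj c
      by_cases hc : c ∈ bondsOf (𝔹 j)
      · simp only [if_pos hc]
        have h := hasDerivAt_iff_isLittleO.1 (hX j (Nat.le_of_lt_succ (Finset.mem_range.1 hj)) c hc)
        have hW : ((W j c : SU N) : Matrix (Fin N) (Fin N) ℂ) =
            ((avgFamily (avOfRecord F N K) (expChart U ((0 : ℝ) • X)) j c : SU N) : Matrix (Fin N) (Fin N) ℂ) := by
          rw [zero_smul, expChart_zero, hfib j c hc]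
        simp only [sub_zero, smul_zero] at h
        rw [hW]
        exact h.norm_left
      · simp only [if_neg hc]
        exact isLittleO_zero _ _
    exact IsLittleO.sum (s := Finset.range (k₀ + 1)) fun j hj =>
      IsLittleO.sum (s := (Finset.univ : Finset (PBond (F.P K) j))) fun c _ => hterm j hj c
  -- the good set: the ray is bond-wise `ρ`-close to `U`
  have hgood : ∀ᶠ t in 𝓝 (0 : ℝ), ∀ b, ‖((expChart U (t • X) b : SU N) : Matrix (Fin N) (Fin N) ℂ) - (U b : Matrix (Fin N) (Fin N) ℂ)‖ ≤ ρ := by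
    have hray := tendsto_coeField_expChart_ray U X
    simp only [zero_smul, expChart_zero] at hray
    have hball : ∀ᶠ t in 𝓝 (0 : ℝ), dist (coeField (expChart U (t • X))) (coeField U) ≤ ρ :=
      (Metric.tendsto_nhds.1 hray ρ hρ).mono fun t ht => ht.le
    refine hball.mono fun t ht b => ?_
    rw [← dist_eq_norm]
    exact (dist_le_pi_dist (coeField (expChart U (t • X))) (coeField U) b).trans ht
  have hgood0 : ∀ b, ‖((expChart U ((0 : ℝ) • X) b : SU N) : Matrix (Fin N) (Fin N) ℂ) - (U b : Matrix (Fin N) (Fin N) ℂ)‖ ≤ ρ := by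
    intro b
    rw [zero_smul, expChart_zero, sub_self, norm_zero]
    exact hρ.le
  refine exists_curve_of_corrector U X (fun V => AgreeOn 𝔹 (avgFamily (avOfRecord F N K) V) W)
    (η := fun t => D (expChart U (t • X))) (fun t => hD_nonneg _) hDo hD0 (q := q)
    (good := fun t => ∀ b, ‖((expChart U (t • X) b : SU N) : Matrix (Fin N) (Fin N) ℂ) - (U b : Matrix (Fin N) (Fin N) ℂ)‖ ≤ ρ) hgood hgood0 ?_
  intro t ht
  obtain ⟨U'', hU''fib, hU''dist⟩ := hcorr (expChart U (t • X)) ht (D (expChart U (t • X))) (hD_nonneg _)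
    (fun j hj c hc => hD_le _ hj hc)
  exact ⟨U'', hU''fib, hU''dist⟩

/-- ★★★ **CURVE-CRITICAL ⇒ TANGENT-CRITICAL ON THE JOINT (hX : ∀ j, j ≤ k₀ → ∀ c ∈ bondsOf (𝔹 j), HasDerivAt
      (fun t : ℝ => ((avgFamily (avOfRecord F N K) (expChart U (t • X)) j c : SU N) : Matrix (Fin N) (Fin N) ℂ)) 0 0)NEL, EVERY DETERMINING SET, FROM A LOCAL CORRECTOR.**  At NODE 00's objects, for a determining set `𝐁`, a datum `W`, a
configuration `U` ON the fibre `𝔅(𝐁, W)` that is a critical configuration of (5) on it in the CURVE form (`IsCritOnFibre`) and admits a local linear corrector at `U` (levels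
`≤ k₀`, modulus `q`, radius `ρ > 0`): for every joint-kernel direction `X`, `d∕dt A(U·exp(tX))∣_{t=0} = 0` — print's (82) on the multi-scale (83).
[cite: Balaban1985Variational, (3),(5)–(6) p.278, (82)–(83) p.290, (141) p.299, p.300, Prop. 8 p.304; Balaban1988Convergent, (2.2), (2.10)–(2.12) pp.255–256] -/
theorem hasDerivAt_wilsonAction4_expChart_of_isCritOnFibre_of_corrector {K : ℕ} {𝔹 : DetSet (F.P K)} {k₀ : ℕ}
    {W : MSField (F.P K) (SU N)} {U : GaugeField (F.P K) 0 (SU N)} (hfib : AgreeOn 𝔹 (avgFamily (avOfRecord F N K) U) W) {q ρ : ℝ} (hρ : 0 < ρ)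
    (hcorr : ∀ U' : GaugeField (F.P K) 0 (SU N), (∀ b, ‖((U' b : SU N) : Matrix (Fin N) (Fin N) ℂ) - (U b : Matrix (Fin N) (Fin N) ℂ)‖ ≤ ρ) →
      ∀ η : ℝ, 0 ≤ η →
        (∀ j, j ≤ k₀ → ∀ c ∈ bondsOf (𝔹 j),
          ‖((avgFamily (avOfRecord F N K) U' j c : SU N) : Matrix (Fin N) (Fin N) ℂ) - ((W j c : SU N) : Matrix (Fin N) (Fin N) ℂ)‖ ≤ η) →
        ∃ U'' : GaugeField (F.P K) 0 (SU N), AgreeOn 𝔹 (avgFamily (avOfRecord F N K) U'') W ∧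
          ∀ b, ‖((U'' b : SU N) : Matrix (Fin N) (Fin N) ℂ) - (U' b : Matrix (Fin N) (Fin N) ℂ)‖ ≤ q * η) (hcrit : IsCritOnFibre F N K 𝔹 W U) {X : PBond (F.P K) 0 → lieSU (Fin N)}
    (hX : ∀ j, j ≤ k₀ → ∀ c ∈ bondsOf (𝔹 j), HasDerivAt
      (fun t : ℝ => ((avgFamily (avOfRecord F N K) (expChart U (t • X)) j c : SU N) : Matrix (Fin N) (Fin N) ℂ)) 0 0) :
    HasDerivAt (fun t : ℝ => wilsonAction4 (expChart U (t • X))) 0 0 := by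
  obtain ⟨γ, hγ0, hγvel, hγfib⟩ := exists_fibreCurve_of_localCorrector hfib hρ hcorr hX
  have h₂ : ∀ b, HasDerivAt (fun t : ℝ => ((expChart U (t • X) b : SU N) : Matrix (Fin N) (Fin N) ℂ))
      ((U b : Matrix (Fin N) (Fin N) ℂ) * (X b : Matrix (Fin N) (Fin N) ℂ)) 0 :=
    hasDerivAt_coe_expChart_along (U := U) (c := fun t : ℝ => t • X) (hasDerivAt_ray X) (zero_smul ℝ X)
  have h12 : γ 0 = (fun t : ℝ => expChart U (t • X)) 0 := by
    show γ 0 = expChart U ((0 : ℝ) • X)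
    rw [hγ0, zero_smul, expChart_zero]
  have hd : DifferentiableAt ℝ (fun (t : ℝ) (b : PBond (F.P K) 0) => ((γ t b : SU N) : Matrix (Fin N) (Fin N) ℂ)) 0 :=
    (hasDerivAt_pi.2 hγvel).differentiableAt
  have ha := hasDerivAt_wilsonAction4 hγvel (fun p => hasDerivAt_coe_plaqHol hγvel p)
  have ha0 := hcrit γ hγ0 hd hγfib _ ha
  rw [ha0] at ha
  exact hasDerivAt_wilsonAction4_of_sameVelocity h12 hγvel h₂ ha

/-- The conclusion as the vanishing of the plain derivative. [cite: Balaban1985Variational, (82) p.290 (bookkeeping)] -/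
theorem deriv_wilsonAction4_expChart_eq_zero_of_isCritOnFibre_of_corrector {K : ℕ} {𝔹 : DetSet (F.P K)} {k₀ : ℕ}
    {W : MSField (F.P K) (SU N)} {U : GaugeField (F.P K) 0 (SU N)} (hfib : AgreeOn 𝔹 (avgFamily (avOfRecord F N K) U) W) {q ρ : ℝ} (hρ : 0 < ρ)
    (hcorr : ∀ U' : GaugeField (F.P K) 0 (SU N), (∀ b, ‖((U' b : SU N) : Matrix (Fin N) (Fin N) ℂ) - (U b : Matrix (Fin N) (Fin N) ℂ)‖ ≤ ρ) →
      ∀ η : ℝ, 0 ≤ η →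
        (∀ j, j ≤ k₀ → ∀ c ∈ bondsOf (𝔹 j),
          ‖((avgFamily (avOfRecord F N K) U' j c : SU N) : Matrix (Fin N) (Fin N) ℂ) - ((W j c : SU N) : Matrix (Fin N) (Fin N) ℂ)‖ ≤ η) →
        ∃ U'' : GaugeField (F.P K) 0 (SU N), AgreeOn 𝔹 (avgFamily (avOfRecord F N K) U'') W ∧
          ∀ b, ‖((U'' b : SU N) : Matrix (Fin N) (Fin N) ℂ) - (U' b : Matrix (Fin N) (Fin N) ℂ)‖ ≤ q * η) (hcrit : IsCritOnFibre F N K 𝔹 W U) {X : PBond (F.P K) 0 → lieSU (Fin N)}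
    (hX : ∀ j, j ≤ k₀ → ∀ c ∈ bondsOf (𝔹 j), HasDerivAt
      (fun t : ℝ => ((avgFamily (avOfRecord F N K) (expChart U (t • X)) j c : SU N) : Matrix (Fin N) (Fin N) ℂ)) 0 0) :
    deriv (fun t : ℝ => wilsonAction4 (expChart U (t • X))) 0 = 0 :=
  (hasDerivAt_wilsonAction4_expChart_of_isCritOnFibre_of_corrector hfib hρ hcorr hcrit hX).deriv

/-- ★★★ **THE MULTI-SCALE EULER–LAGRANGE EQUATION IN CURRENT FORM FROM A LOCAL CORRECTOR**: under the same hypotheses, for every joint-kernel direction `X` and every `η ≠ 0`,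
`Σ_b Re Tr(U_bX_bU_b⋆ · η·(D^{η*}_U∂U)(b)) = 0` (35f's first variation + uniqueness of the derivative, 35g §1 by name).
[cite: Balaban1985Variational, (82)–(83) p.290, (141) p.299, p.300; Balaban1985RegularSpaces, (1.1)–(1.2) p.76] -/
theorem sum_re_trace_covDivT_eq_zero_of_isCritOnFibre_of_corrector {K : ℕ} {𝔹 : DetSet (F.P K)} {k₀ : ℕ}
    {W : MSField (F.P K) (SU N)} {U : GaugeField (F.P K) 0 (SU N)} (hfib : AgreeOn 𝔹 (avgFamily (avOfRecord F N K) U) W) {q ρ : ℝ} (hρ : 0 < ρ)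
    (hcorr : ∀ U' : GaugeField (F.P K) 0 (SU N), (∀ b, ‖((U' b : SU N) : Matrix (Fin N) (Fin N) ℂ) - (U b : Matrix (Fin N) (Fin N) ℂ)‖ ≤ ρ) →
      ∀ η : ℝ, 0 ≤ η →
        (∀ j, j ≤ k₀ → ∀ c ∈ bondsOf (𝔹 j),
          ‖((avgFamily (avOfRecord F N K) U' j c : SU N) : Matrix (Fin N) (Fin N) ℂ) - ((W j c : SU N) : Matrix (Fin N) (Fin N) ℂ)‖ ≤ η) →
        ∃ U'' : GaugeField (F.P K) 0 (SU N), AgreeOn 𝔹 (avgFamily (avOfRecord F N K) U'') W ∧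
          ∀ b, ‖((U'' b : SU N) : Matrix (Fin N) (Fin N) ℂ) - (U' b : Matrix (Fin N) (Fin N) ℂ)‖ ≤ q * η) (hcrit : IsCritOnFibre F N K 𝔹 W U) {X : PBond (F.P K) 0 → lieSU (Fin N)}
    (hX : ∀ j, j ≤ k₀ → ∀ c ∈ bondsOf (𝔹 j), HasDerivAt
      (fun t : ℝ => ((avgFamily (avOfRecord F N K) (expChart U (t • X)) j c : SU N) : Matrix (Fin N) (Fin N) ℂ)) 0 0)
    {η : ℝ} (hη : η ≠ 0) :
    ∑ b : PBond (F.P K) 0, (Matrix.trace ((U b : Matrix (Fin N) (Fin N) ℂ) * (X b : Matrix (Fin N) (Fin N) ℂ) * star (U b : Matrix (Fin N) (Fin N) ℂ) *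
      (η • covDivT η (unitsField (toUField U)) b.dir b.src))).re = 0 :=
  sum_re_trace_covDivT_eq_zero_of_hasDerivAt_zero U X hη (hasDerivAt_wilsonAction4_expChart_of_isCritOnFibre_of_corrector hfib hρ hcorr hcrit hX)

end MultiScale

end Summit.QuantumFields.YangMills.BalabanUVNodes.N07CritMultiScaleOfCorrector

end
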